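import Summits.NavierStokesRegularity.NavierStokesRegularity.Theorems.QuarterLogPincerLogCubeSharpPhiTools
import Literature.Analysis.FluidPDE.SelfSimilarProofs
import HarnessLib

/-!
# `QuarterLogPincer.LogCubeSharp` (item stmt-NavierStokesRegularity-23935), rung 2, the slice
# identities: dissipation has a sign, transport vanishes, the pressure pairs with `|u||∇u|`

Helper file (`--supports stmt-NavierStokesRegularity-23935`) of the crux `LogCubeSharp` of route
`QuarterLogPincer`. At a fixed time, for a smooth divergence-free field `u` on a finite-dimensional
inner product space with `u ∈ L² ∩ L^∞`, `Du, D²u ∈ L²`, a smooth scalar `q` with `q, ∇q ∈ L²`, and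
the weight `ρ = √(‖u‖²+1)` of the regularised cube `Φ(u) = ρ³ − 1` (so that
`d/dt ∫Φ(u) = 3∫ρ⟪u, ∂ₜu⟫ = 3∫ρ⟪u, νΔu − (u·∇)u − ∇q⟫` along a classical Navier–Stokes flow), the
three whole-space integrations by parts of the `L³` energy identity, in `L¹` form (no compact
support: the tree's `integral_mul_divergence_add_eq_zero_of_integrable` and Mathlib's
`integral_bilinear_hasFDerivAt_right_eq_neg_left_of_integrable`):

* `integral_rho_inner_laplacian_nonpos` — DISSIPATION: `∫ ρ⟪u, Δu⟫ ≤ 0`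
  (`= −Σᵢ∫ (ρ‖∂ᵢu‖² + ρ⁻¹⟪u, ∂ᵢu⟫²)`); `integral_rho_inner_convect_eq_zero` — TRANSPORT: `= 0`;
* `integral_rho_inner_gradient_eq`, `abs_integral_rho_inner_gradient_le` — PRESSURE:
  `∫ ρ⟪u, ∇q⟫ = −∫ q ρ⁻¹⟪u, Du(u)⟫`, hence `|∫ ρ⟪u, ∇q⟫| ≤ ∫ |q| ‖u‖ ‖Du‖` — the derivative lands
  on `ρ`, not on `q` (template-sharp: `≤ ‖u‖_∞ ‖q‖₂ ‖Du‖₂ ≲ (T−t)^{-1}`).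
HONEST FRAMING: calculus identities for a fixed field; nothing here concerns Navier–Stokes
regularity; the crux is NOT closed by this file. [folklore] -/

noncomputable section

open MeasureTheory TopologicalSpace Set Function Filter Topology InnerProductSpace
open Literature.Analysis Literature.Analysis.FluidPDE
open scoped RealInnerProductSpace ENNReal NNReal Laplacian

namespace Summit.NavierStokesRegularity.NavierStokesRegularity.Theorems

-- the problem directory repeats the summit name (`NavierStokesRegularity/NavierStokesRegularity`)
set_option linter.dupNamespace false

namespace LogCubeSharp

/-! ### The slice identities on the whole space -/

section Slice

variable {E : Type*} [NormedAddCommGroup E] [InnerProductSpace ℝ E] [FiniteDimensional ℝ E]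
  [MeasurableSpace E] [BorelSpace E]

/-- **The transport term vanishes**: for a `C¹` divergence-free field `u` with `u ∈ L² ∩ L^∞`,
`Du ∈ L²`, `∫ ρ ⟪u, Du(u)⟫ = 0` where `ρ = √(‖u‖²+1)` (the integrand is `⅓ ⟪u, ∇Φ(u)⟫` with
`Φ(u) = ρ³ − 1`, and `∫ ⟪u, ∇Φ⟫ = −∫ (div u) Φ = 0`). [folklore] -/
theorem integral_rho_inner_convect_eq_zero {u : E → E} (hu : ContDiff ℝ 1 u)
    (hdiv : VectorCalculus.IsDivFree u) {M : ℝ} (hM : ∀ x, ‖u x‖ ≤ M)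
    (hu2 : MemLp u 2 volume) (hDu : MemLp (fun x => fderiv ℝ u x) 2 volume) :
    ∫ x, Real.sqrt (‖u x‖ ^ 2 + 1) * ⟪u x, fderiv ℝ u x (u x)⟫ = 0 := by
  have hM0 : 0 ≤ M := (norm_nonneg _).trans (hM 0)
  set θ : E → ℝ := fun y => Real.sqrt (‖u y‖ ^ 2 + 1) ^ 3 - 1 with hθ
  have hθ1 : ContDiff ℝ 1 θ := contDiff_phi hu
  have hud : ∀ x, DifferentiableAt ℝ u x := fun x => hu.differentiable one_ne_zero x
  have huc : Continuous u := hu.continuous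
  have hDuc : Continuous fun x => fderiv ℝ u x := hu.continuous_fderiv one_ne_zero
  have hθc : Continuous θ := hθ1.continuous
  -- pointwise: `⟪u, ∇θ⟫ = 3ρ ⟪u, Du u⟫`, `|θ| ≤ (M + 3/2)‖u‖²`
  have hgrad : ∀ x, ⟪u x, gradient θ x⟫ =
      3 * Real.sqrt (‖u x‖ ^ 2 + 1) * ⟪u x, fderiv ℝ u x (u x)⟫ := fun x => by
    rw [real_inner_gradient_right, hθ, fderiv_phi_apply (hud x)]
  have hθle : ∀ x, |θ x| ≤ (M + 3 / 2) * ‖u x‖ ^ 2 := fun x => by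
    rw [abs_of_nonneg (phi_nonneg (u x))]
    refine (phi_le (u x)).trans ?_
    gcongr
    exact hM x
  -- integrability
  have hint : Integrable (fun x => θ x • u x) volume := by
    refine Integrable.mono' ((integrable_norm_sq hu2).const_mul ((M + 3 / 2) * M))
      (hθc.smul huc).aestronglyMeasurable (Eventually.of_forall fun x => ?_)
    rw [norm_smul, Real.norm_eq_abs]
    calc |θ x| * ‖u x‖ ≤ (M + 3 / 2) * ‖u x‖ ^ 2 * M :=
          mul_le_mul (hθle x) (hM x) (norm_nonneg _) (by positivity)
      _ = (M + 3 / 2) * M * ‖u x‖ ^ 2 := by ring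
  have h₁ : Integrable (fun x => θ x * VectorCalculus.divergence u x) volume := by
    rw [show (fun x => θ x * VectorCalculus.divergence u x) = fun _ => (0 : ℝ) from
      funext fun x => by rw [hdiv x, mul_zero]]; exact integrable_zero _ _ _
  have h₂ : Integrable (fun x => ⟪u x, gradient θ x⟫) volume := by
    refine Integrable.mono' ((integrable_norm_mul_norm hu2 hDu).const_mul (3 * (M + 1) * M))
      ?_ (Eventually.of_forall fun x => ?_)
    · have : Continuous fun x => ⟪u x, gradient θ x⟫ := by
        simp_rw [hgrad]
        exact ((continuous_const.mul ((huc.norm.pow 2).add continuous_const).sqrt).mul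
          (huc.inner (hDuc.clm_apply huc)))
      exact this.aestronglyMeasurable
    · rw [hgrad, Real.norm_eq_abs]
      have hρ : Real.sqrt (‖u x‖ ^ 2 + 1) ≤ M + 1 :=
        (sqrt_normSq_add_one_le (u x)).trans (by linarith [hM x])
      have hρ0 : 0 ≤ Real.sqrt (‖u x‖ ^ 2 + 1) := Real.sqrt_nonneg _
      calc |3 * Real.sqrt (‖u x‖ ^ 2 + 1) * ⟪u x, fderiv ℝ u x (u x)⟫|
          = 3 * Real.sqrt (‖u x‖ ^ 2 + 1) * |⟪u x, fderiv ℝ u x (u x)⟫| := by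
            rw [abs_mul, abs_of_nonneg (by positivity)]
        _ ≤ 3 * (M + 1) * (‖u x‖ * (‖fderiv ℝ u x‖ * M)) := by
            gcongr
            refine (abs_real_inner_le_norm _ _).trans ?_
            gcongr
            exact (ContinuousLinearMap.le_opNorm _ _).trans (by gcongr; exact hM x)
        _ = 3 * (M + 1) * M * (‖u x‖ * ‖fderiv ℝ u x‖) := by ring
  have key := integral_mul_divergence_add_eq_zero_of_integrable hθ1 hu hint h₁ h₂
  have hz : ∫ x, θ x * VectorCalculus.divergence u x = 0 := by
    rw [show (fun x => θ x * VectorCalculus.divergence u x) = fun _ => (0 : ℝ) from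
      funext fun x => by rw [hdiv x, mul_zero], integral_zero]
  rw [hz, zero_add] at key
  simp_rw [hgrad] at key
  have : ∫ x, 3 * Real.sqrt (‖u x‖ ^ 2 + 1) * ⟪u x, fderiv ℝ u x (u x)⟫ =
      3 * ∫ x, Real.sqrt (‖u x‖ ^ 2 + 1) * ⟪u x, fderiv ℝ u x (u x)⟫ := by
    rw [← integral_const_mul]
    refine integral_congr_ae (Eventually.of_forall fun x => ?_)
    simp only; ring
  rw [this] at key
  linarith

/-- **The pressure term, integrated by parts**: for `C¹` data, `u` divergence free with
`u ∈ L² ∩ L^∞`, `Du ∈ L²`, `q, ∇q ∈ L²`,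
`∫ ρ ⟪u, ∇q⟫ = −∫ q ρ⁻¹⟪u, Du(u)⟫` where `ρ = √(‖u‖²+1)` (`div (ρu) = ⟪u, ∇ρ⟫ = ρ⁻¹⟪u, Du u⟫`).
[folklore] -/
theorem integral_rho_inner_gradient_eq {u : E → E} {q : E → ℝ} (hu : ContDiff ℝ 1 u)
    (hdiv : VectorCalculus.IsDivFree u) (hq : ContDiff ℝ 1 q) {M : ℝ} (hM : ∀ x, ‖u x‖ ≤ M)
    (hu2 : MemLp u 2 volume) (hDu : MemLp (fun x => fderiv ℝ u x) 2 volume)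
    (hq2 : MemLp q 2 volume) (hDq : MemLp (fun x => gradient q x) 2 volume) :
    ∫ x, Real.sqrt (‖u x‖ ^ 2 + 1) * ⟪u x, gradient q x⟫ =
      -∫ x, q x * ((Real.sqrt (‖u x‖ ^ 2 + 1))⁻¹ * ⟪u x, fderiv ℝ u x (u x)⟫) := by
  have hM0 : 0 ≤ M := (norm_nonneg _).trans (hM 0)
  set ρ : E → ℝ := fun y => Real.sqrt (‖u y‖ ^ 2 + 1) with hρ
  have hρ1 : ContDiff ℝ 1 ρ := contDiff_sqrt_normSq_add_one hu
  have hud : ∀ x, DifferentiableAt ℝ u x := fun x => hu.differentiable one_ne_zero x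
  have hρd : ∀ x, DifferentiableAt ℝ ρ x := fun x => hρ1.differentiable one_ne_zero x
  have huc : Continuous u := hu.continuous
  have hqc : Continuous q := hq.continuous
  have hDuc : Continuous fun x => fderiv ℝ u x := hu.continuous_fderiv one_ne_zero
  have hρc : Continuous ρ := hρ1.continuous
  have hgradc : Continuous fun x => gradient q x :=
    (InnerProductSpace.toDual ℝ E).symm.continuous.comp (hq.continuous_fderiv one_ne_zero)
  have hρle : ∀ x, ρ x ≤ M + 1 := fun x =>
    (sqrt_normSq_add_one_le (u x)).trans (by linarith [hM x])
  have hρpos : ∀ x, 0 < ρ x := fun x => sqrt_normSq_add_one_pos (u x)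
  -- the field `ρ • u` is `C¹` with divergence `⟪u, ∇ρ⟫ = ρ⁻¹ ⟪u, Du u⟫`
  have hρu : ContDiff ℝ 1 (fun y => ρ y • u y) := hρ1.smul hu
  have hdivρu : ∀ x, VectorCalculus.divergence (fun y => ρ y • u y) x =
      (ρ x)⁻¹ * ⟪u x, fderiv ℝ u x (u x)⟫ := fun x => by
    rw [divergence_smul_apply (hρd x) (hud x), hdiv x, mul_zero, zero_add,
      real_inner_gradient_right, hρ, fderiv_sqrt_normSq_add_one_apply (hud x)]
  -- pointwise bound `|ρ⁻¹ ⟪u, Du u⟫| ≤ ‖u‖ ‖Du‖`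
  have hbd : ∀ x, |(ρ x)⁻¹ * ⟪u x, fderiv ℝ u x (u x)⟫| ≤ ‖u x‖ * ‖fderiv ℝ u x‖ := by
    intro x
    have h1 : ‖u x‖ ≤ ρ x := norm_le_sqrt_normSq_add_one (u x)
    rw [abs_mul, abs_of_pos (inv_pos.2 (hρpos x))]
    calc (ρ x)⁻¹ * |⟪u x, fderiv ℝ u x (u x)⟫|
        ≤ (ρ x)⁻¹ * (‖u x‖ * (‖fderiv ℝ u x‖ * ‖u x‖)) := by
          gcongr
          exact (abs_real_inner_le_norm _ _).trans (by gcongr; exact ContinuousLinearMap.le_opNorm _ _)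
      _ = (‖u x‖ * (ρ x)⁻¹) * (‖u x‖ * ‖fderiv ℝ u x‖) := by ring
      _ ≤ 1 * (‖u x‖ * ‖fderiv ℝ u x‖) := by
          gcongr
          rw [mul_inv_le_iff₀ (hρpos x), one_mul]
          exact h1
      _ = ‖u x‖ * ‖fderiv ℝ u x‖ := one_mul _
  -- integrability
  have hint : Integrable (fun x => q x • (ρ x • u x)) volume := by
    refine Integrable.mono' ((integrable_norm_mul_norm hq2 hu2).const_mul (M + 1))
      (hqc.smul (hρc.smul huc)).aestronglyMeasurable (Eventually.of_forall fun x => ?_)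
    rw [norm_smul, norm_smul, Real.norm_eq_abs, Real.norm_eq_abs, abs_of_pos (hρpos x)]
    calc |q x| * (ρ x * ‖u x‖) = ρ x * (|q x| * ‖u x‖) := by ring
      _ ≤ (M + 1) * (‖q x‖ * ‖u x‖) := by
          rw [Real.norm_eq_abs]; gcongr; exact hρle x
  have h₁ : Integrable (fun x => q x * VectorCalculus.divergence (fun y => ρ y • u y) x) volume := by
    refine Integrable.mono' ((integrable_norm_mul_norm hq2 hDu).const_mul M) ?_
      (Eventually.of_forall fun x => ?_)
    · simp_rw [hdivρu]
      exact (hqc.mul ((hρc.inv₀ fun x => (hρpos x).ne').mul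
        (huc.inner (hDuc.clm_apply huc)))).aestronglyMeasurable
    · rw [hdivρu, norm_mul, Real.norm_eq_abs, Real.norm_eq_abs]
      calc |q x| * |(ρ x)⁻¹ * ⟪u x, fderiv ℝ u x (u x)⟫|
          ≤ |q x| * (‖u x‖ * ‖fderiv ℝ u x‖) := by gcongr; exact hbd x
        _ ≤ |q x| * (M * ‖fderiv ℝ u x‖) := by gcongr; exact hM x
        _ = M * (‖q x‖ * ‖fderiv ℝ u x‖) := by rw [Real.norm_eq_abs]; ring
  have h₂ : Integrable (fun x => ⟪ρ x • u x, gradient q x⟫) volume := by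
    refine Integrable.mono' ((integrable_norm_mul_norm hu2 hDq).const_mul (M + 1))
      ((hρc.smul huc).inner hgradc).aestronglyMeasurable (Eventually.of_forall fun x => ?_)
    rw [Real.norm_eq_abs]
    calc |⟪ρ x • u x, gradient q x⟫| ≤ ‖ρ x • u x‖ * ‖gradient q x‖ := abs_real_inner_le_norm _ _
      _ = ρ x * (‖u x‖ * ‖gradient q x‖) := by
          rw [norm_smul, Real.norm_eq_abs, abs_of_pos (hρpos x)]; ring
      _ ≤ (M + 1) * (‖u x‖ * ‖gradient q x‖) := by gcongr; exact hρle x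
  have key := integral_mul_divergence_add_eq_zero_of_integrable hq hρu hint h₁ h₂
  simp_rw [hdivρu, real_inner_smul_left] at key
  linarith

/-- **The pressure term is bounded by `∫ |q| ‖u‖ ‖Du‖`.** [folklore] -/
theorem abs_integral_rho_inner_gradient_le {u : E → E} {q : E → ℝ} (hu : ContDiff ℝ 1 u)
    (hdiv : VectorCalculus.IsDivFree u) (hq : ContDiff ℝ 1 q) {M : ℝ} (hM : ∀ x, ‖u x‖ ≤ M)
    (hu2 : MemLp u 2 volume) (hDu : MemLp (fun x => fderiv ℝ u x) 2 volume)
    (hq2 : MemLp q 2 volume) (hDq : MemLp (fun x => gradient q x) 2 volume) :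
    |∫ x, Real.sqrt (‖u x‖ ^ 2 + 1) * ⟪u x, gradient q x⟫| ≤
      ∫ x, ‖q x‖ * (‖u x‖ * ‖fderiv ℝ u x‖) := by
  rw [integral_rho_inner_gradient_eq hu hdiv hq hM hu2 hDu hq2 hDq, abs_neg]
  have hρpos : ∀ x, 0 < Real.sqrt (‖u x‖ ^ 2 + 1) := fun x => sqrt_normSq_add_one_pos (u x)
  have hbd : ∀ x, |(Real.sqrt (‖u x‖ ^ 2 + 1))⁻¹ * ⟪u x, fderiv ℝ u x (u x)⟫| ≤
      ‖u x‖ * ‖fderiv ℝ u x‖ := by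
    intro x
    have h1 : ‖u x‖ ≤ Real.sqrt (‖u x‖ ^ 2 + 1) := norm_le_sqrt_normSq_add_one (u x)
    rw [abs_mul, abs_of_pos (inv_pos.2 (hρpos x))]
    calc (Real.sqrt (‖u x‖ ^ 2 + 1))⁻¹ * |⟪u x, fderiv ℝ u x (u x)⟫|
        ≤ (Real.sqrt (‖u x‖ ^ 2 + 1))⁻¹ * (‖u x‖ * (‖fderiv ℝ u x‖ * ‖u x‖)) := by
          gcongr
          exact (abs_real_inner_le_norm _ _).trans (by gcongr; exact ContinuousLinearMap.le_opNorm _ _)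
      _ = (‖u x‖ * (Real.sqrt (‖u x‖ ^ 2 + 1))⁻¹) * (‖u x‖ * ‖fderiv ℝ u x‖) := by ring
      _ ≤ 1 * (‖u x‖ * ‖fderiv ℝ u x‖) := by
          gcongr
          rw [mul_inv_le_iff₀ (hρpos x), one_mul]
          exact h1
      _ = ‖u x‖ * ‖fderiv ℝ u x‖ := one_mul _
  calc |∫ x, q x * ((Real.sqrt (‖u x‖ ^ 2 + 1))⁻¹ * ⟪u x, fderiv ℝ u x (u x)⟫)|
      ≤ ∫ x, |q x * ((Real.sqrt (‖u x‖ ^ 2 + 1))⁻¹ * ⟪u x, fderiv ℝ u x (u x)⟫)| := by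
        rw [← Real.norm_eq_abs]
        exact (norm_integral_le_integral_norm _).trans (le_of_eq (by simp [Real.norm_eq_abs]))
    _ ≤ ∫ x, ‖q x‖ * (‖u x‖ * ‖fderiv ℝ u x‖) := by
        have hM0 : 0 ≤ M := (norm_nonneg _).trans (hM 0)
        have hgi : Integrable (fun x => ‖q x‖ * (‖u x‖ * ‖fderiv ℝ u x‖)) volume := by
          refine Integrable.mono' ((integrable_norm_mul_norm hq2 hDu).const_mul M)
            ((hq.continuous.norm.mul (hu.continuous.norm.mul
              (hu.continuous_fderiv one_ne_zero).norm)).aestronglyMeasurable)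
            (Eventually.of_forall fun x => ?_)
          rw [Real.norm_eq_abs, abs_of_nonneg (by positivity)]
          calc ‖q x‖ * (‖u x‖ * ‖fderiv ℝ u x‖) ≤ ‖q x‖ * (M * ‖fderiv ℝ u x‖) := by
                gcongr; exact hM x
            _ = M * (‖q x‖ * ‖fderiv ℝ u x‖) := by ring
        refine integral_mono_of_nonneg (Eventually.of_forall fun x => abs_nonneg _) hgi
          (Eventually.of_forall fun x => ?_)
        show |q x * ((Real.sqrt (‖u x‖ ^ 2 + 1))⁻¹ * ⟪u x, fderiv ℝ u x (u x)⟫)| ≤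
          ‖q x‖ * (‖u x‖ * ‖fderiv ℝ u x‖)
        rw [abs_mul, Real.norm_eq_abs]
        gcongr
        exact hbd x

/-- **The dissipation term has a sign**: for a `C²` field `u` with `u ∈ L² ∩ L^∞`, `Du ∈ L²`,
`D²u ∈ L²`, `∫ ρ ⟪u, Δu⟫ ≤ 0` where `ρ = √(‖u‖²+1)`: coordinatewise integration by parts gives
`∫ ρ⟪u, ∂ᵢ∂ᵢu⟫ = −∫ ⟪∂ᵢ(ρu), ∂ᵢu⟫ = −∫ (ρ‖∂ᵢu‖² + ρ⁻¹⟪u, ∂ᵢu⟫²) ≤ 0`. [folklore] -/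
theorem integral_rho_inner_laplacian_nonpos {u : E → E} (hu : ContDiff ℝ 2 u) {M : ℝ}
    (hM : ∀ x, ‖u x‖ ≤ M) (hu2 : MemLp u 2 volume)
    (hDu : MemLp (fun x => fderiv ℝ u x) 2 volume)
    (hD2u : MemLp (fun x => iteratedFDeriv ℝ 2 u x) 2 volume) :
    ∫ x, Real.sqrt (‖u x‖ ^ 2 + 1) * ⟪u x, (Δ u) x⟫ ≤ 0 := by
  have hM0 : 0 ≤ M := (norm_nonneg _).trans (hM 0)
  let b := stdOrthonormalBasis ℝ E
  set ρ : E → ℝ := fun y => Real.sqrt (‖u y‖ ^ 2 + 1) with hρ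
  have hu1 : ContDiff ℝ 1 u := hu.of_le (by norm_num)
  have hρ1 : ContDiff ℝ 1 ρ := contDiff_sqrt_normSq_add_one hu1
  have hud : ∀ x, DifferentiableAt ℝ u x := fun x => hu1.differentiable one_ne_zero x
  have huc : Continuous u := hu.continuous
  have hDuc : Continuous fun x => fderiv ℝ u x := hu.continuous_fderiv (by norm_num)
  have hρc : Continuous ρ := hρ1.continuous
  have hρle : ∀ x, ρ x ≤ M + 1 := fun x =>
    (sqrt_normSq_add_one_le (u x)).trans (by linarith [hM x])
  have hρpos : ∀ x, 0 < ρ x := fun x => sqrt_normSq_add_one_pos (u x)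
  have huρ : ∀ x, ‖u x‖ ≤ ρ x := fun x => norm_le_sqrt_normSq_add_one (u x)
  have hb1 : ∀ i, ‖b i‖ = 1 := fun i => b.orthonormal.1 i
  -- the field `f = ρ • u` and its derivative
  set f : E → E := fun y => ρ y • u y with hf
  set ρD : E → (E →L[ℝ] ℝ) := fun x => (ρ x)⁻¹ • (innerSL ℝ (u x)).comp (fderiv ℝ u x) with hρD
  set f' : E → (E →L[ℝ] E) := fun x => ρ x • fderiv ℝ u x + (ρD x).smulRight (u x) with hf'
  have hff' : ∀ x, HasFDerivAt f (f' x) x := fun x =>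
    (hasFDerivAt_sqrt_normSq_add_one (hud x).hasFDerivAt).smul (hud x).hasFDerivAt
  have hf'app : ∀ x v, f' x v = ρ x • fderiv ℝ u x v + ((ρ x)⁻¹ * ⟪u x, fderiv ℝ u x v⟫) • u x := by
    intro x v
    simp only [hf', hρD, _root_.add_apply, _root_.smul_apply,
      ContinuousLinearMap.smulRight_apply, ContinuousLinearMap.comp_apply, innerSL_apply_apply,
      smul_eq_mul]
  have hfc : Continuous f := hρc.smul huc
  have hfle : ∀ x, ‖f x‖ ≤ (M + 1) * ‖u x‖ := fun x => by
    rw [hf, norm_smul, Real.norm_eq_abs, abs_of_pos (hρpos x)]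
    exact mul_le_mul_of_nonneg_right (hρle x) (norm_nonneg _)
  have hf'le : ∀ x v, ‖f' x v‖ ≤ (2 * M + 1) * (‖fderiv ℝ u x‖ * ‖v‖) := by
    intro x v
    rw [hf'app]
    have h1 : ‖ρ x • fderiv ℝ u x v‖ ≤ (M + 1) * (‖fderiv ℝ u x‖ * ‖v‖) := by
      rw [norm_smul, Real.norm_eq_abs, abs_of_pos (hρpos x)]
      exact mul_le_mul (hρle x) (ContinuousLinearMap.le_opNorm _ _) (norm_nonneg _) (by linarith)
    have h2 : ‖((ρ x)⁻¹ * ⟪u x, fderiv ℝ u x v⟫) • u x‖ ≤ M * (‖fderiv ℝ u x‖ * ‖v‖) := by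
      rw [norm_smul, Real.norm_eq_abs, abs_mul, abs_of_pos (inv_pos.2 (hρpos x))]
      calc (ρ x)⁻¹ * |⟪u x, fderiv ℝ u x v⟫| * ‖u x‖
          ≤ (ρ x)⁻¹ * (‖u x‖ * (‖fderiv ℝ u x‖ * ‖v‖)) * ‖u x‖ := by
            gcongr
            exact (abs_real_inner_le_norm _ _).trans (by gcongr; exact ContinuousLinearMap.le_opNorm _ _)
        _ = (‖u x‖ * (ρ x)⁻¹) * ‖u x‖ * (‖fderiv ℝ u x‖ * ‖v‖) := by ring
        _ ≤ 1 * M * (‖fderiv ℝ u x‖ * ‖v‖) := by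
            gcongr
            · rw [mul_inv_le_iff₀ (hρpos x), one_mul]; exact huρ x
            · exact hM x
        _ = M * (‖fderiv ℝ u x‖ * ‖v‖) := by ring
    calc ‖ρ x • fderiv ℝ u x v + ((ρ x)⁻¹ * ⟪u x, fderiv ℝ u x v⟫) • u x‖
        ≤ ‖ρ x • fderiv ℝ u x v‖ + ‖((ρ x)⁻¹ * ⟪u x, fderiv ℝ u x v⟫) • u x‖ := norm_add_le _ _
      _ ≤ (M + 1) * (‖fderiv ℝ u x‖ * ‖v‖) + M * (‖fderiv ℝ u x‖ * ‖v‖) := add_le_add h1 h2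
      _ = (2 * M + 1) * (‖fderiv ℝ u x‖ * ‖v‖) := by ring
  -- the coordinate fields `gᵢ = ∂ᵢu` and their derivatives
  have hDu1 : ContDiff ℝ 1 (fun y => fderiv ℝ u y) := hu.fderiv_right (m := 1) le_rfl
  have hg1 : ∀ i, ContDiff ℝ 1 (fun y => fderiv ℝ u y (b i)) := fun i =>
    hDu1.clm_apply contDiff_const
  have hgg' : ∀ i x, HasFDerivAt (fun y => fderiv ℝ u y (b i))
      (fderiv ℝ (fun y => fderiv ℝ u y (b i)) x) x := fun i x =>
    ((hg1 i).differentiable one_ne_zero x).hasFDerivAt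
  have hg'c : ∀ i, Continuous fun x => fderiv ℝ (fun y => fderiv ℝ u y (b i)) x := fun i =>
    (hg1 i).continuous_fderiv one_ne_zero
  have hg'le : ∀ i x, ‖fderiv ℝ (fun y => fderiv ℝ u y (b i)) x (b i)‖ ≤ ‖iteratedFDeriv ℝ 2 u x‖ := by
    intro i x
    rw [fderiv_fderiv_apply_const hu x (b i)]
    refine (ContinuousMultilinearMap.le_opNorm _ _).trans ?_
    simp [Fin.prod_univ_two, hb1]
  -- the Laplacian as a sum, and the integrand as a sum
  have hsum : ∀ x, ρ x * ⟪u x, (Δ u) x⟫ =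
      ∑ i, innerSL ℝ (f x) (fderiv ℝ (fun y => fderiv ℝ u y (b i)) x (b i)) := by
    intro x
    rw [laplacian_eq_sum_fderiv_fderiv b hu x, inner_sum, Finset.mul_sum]
    refine Finset.sum_congr rfl fun i _ => ?_
    rw [innerSL_apply_apply, hf, real_inner_smul_left]
  -- integration by parts in each coordinate
  have hIBP : ∀ i, ∫ x, innerSL ℝ (f x) (fderiv ℝ (fun y => fderiv ℝ u y (b i)) x (b i)) =
      -∫ x, innerSL ℝ (f' x (b i)) (fderiv ℝ u x (b i)) := by
    intro i
    refine integral_bilinear_hasFDerivAt_right_eq_neg_left_of_integrable (μ := volume)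
      (B := innerSL ℝ) ?_ ?_ ?_ (fun x _ => hff' x) (fun x _ => hgg' i x)
    · -- `⟪f' bᵢ, ∂ᵢu⟫ ∈ L¹`
      refine Integrable.mono' ((integrable_norm_sq hDu).const_mul (2 * M + 1)) ?_
        (Eventually.of_forall fun x => ?_)
      · have hc : Continuous fun x => f' x (b i) := by
          simp_rw [hf'app]
          exact ((hρc.smul (hDuc.clm_apply continuous_const)).add
            (((hρc.inv₀ fun x => (hρpos x).ne').mul (huc.inner (hDuc.clm_apply continuous_const))).smul huc))
        exact (hc.inner (hDuc.clm_apply continuous_const)).aestronglyMeasurable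
      · rw [innerSL_apply_apply, Real.norm_eq_abs]
        calc |⟪f' x (b i), fderiv ℝ u x (b i)⟫| ≤ ‖f' x (b i)‖ * ‖fderiv ℝ u x (b i)‖ :=
              abs_real_inner_le_norm _ _
          _ ≤ (2 * M + 1) * (‖fderiv ℝ u x‖ * ‖b i‖) * (‖fderiv ℝ u x‖ * ‖b i‖) :=
              mul_le_mul (hf'le x (b i)) (ContinuousLinearMap.le_opNorm _ _) (norm_nonneg _)
                (by positivity)
          _ = (2 * M + 1) * ‖fderiv ℝ u x‖ ^ 2 := by rw [hb1]; ring
    · -- `⟪f, ∂ᵢ∂ᵢu⟫ ∈ L¹`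
      refine Integrable.mono' ((integrable_norm_mul_norm hu2 hD2u).const_mul (M + 1))
        ((hfc.inner ((hg'c i).clm_apply continuous_const)).aestronglyMeasurable)
        (Eventually.of_forall fun x => ?_)
      rw [innerSL_apply_apply, Real.norm_eq_abs]
      calc |⟪f x, fderiv ℝ (fun y => fderiv ℝ u y (b i)) x (b i)⟫|
          ≤ ‖f x‖ * ‖fderiv ℝ (fun y => fderiv ℝ u y (b i)) x (b i)‖ := abs_real_inner_le_norm _ _
        _ ≤ (M + 1) * ‖u x‖ * ‖iteratedFDeriv ℝ 2 u x‖ :=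
            mul_le_mul (hfle x) (hg'le i x) (norm_nonneg _) (by positivity)
        _ = (M + 1) * (‖u x‖ * ‖iteratedFDeriv ℝ 2 u x‖) := by ring
    · -- `⟪f, ∂ᵢu⟫ ∈ L¹`
      refine Integrable.mono' ((integrable_norm_mul_norm hu2 hDu).const_mul (M + 1))
        ((hfc.inner (hDuc.clm_apply continuous_const)).aestronglyMeasurable)
        (Eventually.of_forall fun x => ?_)
      rw [innerSL_apply_apply, Real.norm_eq_abs]
      calc |⟪f x, fderiv ℝ u x (b i)⟫| ≤ ‖f x‖ * ‖fderiv ℝ u x (b i)‖ := abs_real_inner_le_norm _ _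
        _ ≤ (M + 1) * ‖u x‖ * (‖fderiv ℝ u x‖ * ‖b i‖) :=
            mul_le_mul (hfle x) (ContinuousLinearMap.le_opNorm _ _) (norm_nonneg _) (by positivity)
        _ = (M + 1) * (‖u x‖ * ‖fderiv ℝ u x‖) := by rw [hb1]; ring
  -- each coordinate term is nonpositive
  have hnonneg : ∀ i x, 0 ≤ innerSL ℝ (f' x (b i)) (fderiv ℝ u x (b i)) := by
    intro i x
    rw [innerSL_apply_apply, hf'app, inner_add_left, real_inner_smul_left, real_inner_smul_left,
      real_inner_self_eq_norm_sq]
    have h1 : 0 ≤ ρ x * ‖fderiv ℝ u x (b i)‖ ^ 2 := by positivity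
    have h2 : 0 ≤ (ρ x)⁻¹ * ⟪u x, fderiv ℝ u x (b i)⟫ * ⟪u x, fderiv ℝ u x (b i)⟫ := by
      rw [mul_assoc]
      exact mul_nonneg (inv_nonneg.2 (hρpos x).le) (mul_self_nonneg _)
    linarith
  -- assemble
  have hint_i : ∀ i, Integrable (fun x => innerSL ℝ (f x)
      (fderiv ℝ (fun y => fderiv ℝ u y (b i)) x (b i))) volume := by
    intro i
    refine Integrable.mono' ((integrable_norm_mul_norm hu2 hD2u).const_mul (M + 1))
      ((hfc.inner ((hg'c i).clm_apply continuous_const)).aestronglyMeasurable)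
      (Eventually.of_forall fun x => ?_)
    rw [innerSL_apply_apply, Real.norm_eq_abs]
    calc |⟪f x, fderiv ℝ (fun y => fderiv ℝ u y (b i)) x (b i)⟫|
        ≤ ‖f x‖ * ‖fderiv ℝ (fun y => fderiv ℝ u y (b i)) x (b i)‖ := abs_real_inner_le_norm _ _
      _ ≤ (M + 1) * ‖u x‖ * ‖iteratedFDeriv ℝ 2 u x‖ :=
          mul_le_mul (hfle x) (hg'le i x) (norm_nonneg _) (by positivity)
      _ = (M + 1) * (‖u x‖ * ‖iteratedFDeriv ℝ 2 u x‖) := by ring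
  calc ∫ x, Real.sqrt (‖u x‖ ^ 2 + 1) * ⟪u x, (Δ u) x⟫
      = ∫ x, ∑ i, innerSL ℝ (f x) (fderiv ℝ (fun y => fderiv ℝ u y (b i)) x (b i)) :=
        integral_congr_ae (Eventually.of_forall fun x => hsum x)
    _ = ∑ i, ∫ x, innerSL ℝ (f x) (fderiv ℝ (fun y => fderiv ℝ u y (b i)) x (b i)) :=
        integral_finsetSum _ fun i _ => hint_i i
    _ = ∑ i, -∫ x, innerSL ℝ (f' x (b i)) (fderiv ℝ u x (b i)) :=
        Finset.sum_congr rfl fun i _ => hIBP i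
    _ ≤ 0 := by
        refine Finset.sum_nonpos fun i _ => ?_
        rw [neg_nonpos]
        exact integral_nonneg fun x => hnonneg i x

end Slice

end LogCubeSharp

end Summit.NavierStokesRegularity.NavierStokesRegularity.Theorems

end
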